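import Mathlib
import HarnessLib
import Summits.PneNP.PneNP.Theorems.CnfIdealGenLengthRankDefectRepresentationsOrthogonalFamilyStability

/-!
# Joint exactification of two almost-commuting idempotent families (line rank-dehn-ladder, NOL roadmap)

Crux `stmt-PneNP-18923` (`Summit.PneNP.PneNP.Theses.CnfIdealGenLength.RankDefectRepresentations`), line
`rank-dehn-ladder`, negative side (`Cruxes/RankDefectRepresentations/Lines/rank-dehn-ladder-NOL.md` §5): the LEVEL STEP of the
dyadic weight-refinement scheme.  Given an exact complete orthogonal family of idempotents `P_0,…,P_a` and a second one
`R_0,…,R_b` with `∑_k rank [P_k, R_l] ≤ s` for every `l` (char 0), there is an exact complete orthogonal family `R'` COMMUTING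
with every `P_k` and with `rank (R'_l − R_l) ≤ 10(b+2)²s`.  Proof: compress (`R̃_l = ∑ P_k R_l P_k`, within rank `s`, defects
`≤ 3s`), then re-orthogonalise inside the commutant of `P` — the `K^{b+1}`-stability theorem
`…OrthogonalFamilyStability.orthogonalFamily_stable` re-run with a `P`-averaged generalized inverse `B' = ∑ P_k B P_k`.
HONEST FRAMING: elementary linear algebra; P ≠ NP is not moved; F-N2 is a FRONTIER formal rung.
-/

set_option linter.dupNamespace false -- `Summit.PneNP.PneNP.…`: summit = sub-problem name (D-0017)

namespace Summit.PneNP.PneNP.Theorems.CnfIdealGenLengthRankDefectRepresentationsTwoFamilyStability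

open Finset Polynomial
open Literature.Computability.AlgebraicComplexity (rank_sum_le rank_smul_le)
open Summit.PneNP.PneNP.Theorems.CnfIdealGenLengthRankDefectRepresentationsTseitinTransfer (rk_add rk_sub rk_neg)
open Summit.PneNP.PneNP.Theorems.CnfIdealGenLengthRankDefectRepresentationsNumberOperatorCompression
  (compression_commutes)
open Summit.PneNP.PneNP.Theorems.CnfIdealGenLengthRankDefectRepresentationsWeightDecomposition
  (exists_generalized_inverse aeval_mul_kerProj_eq_zero nodal_dvd_of_eval_eq_zero eval_basis_mul_basis_of_ne
    eval_basis_sq_sub_basis eval_sum_C_mul_basis_sub_X sum_basis_eq_one aeval_mul_comm rank_one_sub_kerProj)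
open Summit.PneNP.PneNP.Theorems.CnfIdealGenLengthRankDefectRepresentationsOrthogonalFamilyStability
  (core_explicit rank_nodal_le rank_lagrange_sub_le)

variable {K : Type} [Field K] {d a b : ℕ}

/-- A generalized inverse can be chosen inside the commutant of an exact complete orthogonal family: average it. -/
theorem exists_generalized_inverse_commuting (P : Fin (a + 1) → Matrix (Fin d) (Fin d) K)
    (hP : ∀ k, P k * P k = P k) (hPorth : ∀ k l, k ≠ l → P k * P l = 0) (hPsum : ∑ k, P k = 1)
    (N : Matrix (Fin d) (Fin d) K) (hN : ∀ k, P k * N = N * P k) :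
    ∃ B : Matrix (Fin d) (Fin d) K, N * B * N = N ∧ ∀ k, P k * B = B * P k := by
  obtain ⟨B₀, hB₀⟩ := exists_generalized_inverse N
  refine ⟨∑ k, P k * B₀ * P k, ?_, fun k => compression_commutes P hP hPorth B₀ k⟩
  have h : ∀ k, N * (P k * B₀ * P k) * N = N * P k := by
    intro k
    calc N * (P k * B₀ * P k) * N = (N * P k) * B₀ * (P k * N) := by simp only [Matrix.mul_assoc]
      _ = (P k * N) * B₀ * (N * P k) := by rw [hN k]
      _ = P k * (N * B₀ * N) * P k := by simp only [Matrix.mul_assoc]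
      _ = N * P k := by rw [hB₀, hN k, Matrix.mul_assoc, hP k]
  rw [Finset.mul_sum, Finset.sum_mul]
  simp only [h, ← Finset.mul_sum, hPsum, mul_one]

/-- A matrix commuting with `D` commutes with every polynomial in `D`. -/
theorem mul_aeval_comm (Pm D : Matrix (Fin d) (Fin d) K) (h : Pm * D = D * Pm) (q : K[X]) :
    Pm * aeval D q = aeval D q * Pm := by
  have hc : Commute Pm D := h
  refine q.induction_on' (fun p q hp hq => by rw [map_add, mul_add, add_mul, hp, hq]) (fun n c => ?_)
  rw [aeval_monomial, ← mul_assoc, ← Algebra.commutes c Pm, mul_assoc, (hc.pow_right n).eq, ← mul_assoc]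

/-- `K^{b+1}`-stability INSIDE THE COMMUTANT of an exact complete orthogonal family `P`: if the near-family `r` commutes
with every `P_k`, the exact family can be chosen commuting with every `P_k` (same bound `3(b+2)²s`). -/
theorem orthogonalFamily_stable_commuting [CharZero K] (P : Fin (a + 1) → Matrix (Fin d) (Fin d) K)
    (hP : ∀ k, P k * P k = P k) (hPorth : ∀ k l, k ≠ l → P k * P l = 0) (hPsum : ∑ k, P k = 1)
    (r : Fin (b + 1) → Matrix (Fin d) (Fin d) K) (s : ℕ)
    (hidem : ∀ l, (r l * r l - r l).rank ≤ s) (horth : ∀ l m, l ≠ m → (r l * r m).rank ≤ s)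
    (hone : (∑ l, r l - 1).rank ≤ s) (hcomm : ∀ k l, P k * r l = r l * P k) :
    ∃ Q : Fin (b + 1) → Matrix (Fin d) (Fin d) K,
      (∀ l, Q l * Q l = Q l) ∧ (∀ l m, l ≠ m → Q l * Q m = 0) ∧ (∑ l, Q l = 1) ∧
      (∀ k l, P k * Q l = Q l * P k) ∧ ∀ m, (Q m - r m).rank ≤ 3 * (b + 2) ^ 2 * s := by
  have hv : Function.Injective (fun k : Fin (b + 1) => ((k : ℕ) : K)) := fun x y h =>
    Fin.ext (Nat.cast_injective (R := K) h)
  have hNrank := rank_nodal_le r s hidem horth hone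
  have hLr := rank_lagrange_sub_le r s hidem horth hone
  have hPD : ∀ k, P k * (∑ l : Fin (b + 1), ((l : ℕ) : K) • r l) = (∑ l : Fin (b + 1), ((l : ℕ) : K) • r l) * P k := by
    intro k
    rw [Finset.mul_sum, Finset.sum_mul]
    refine Finset.sum_congr rfl fun l _ => ?_
    rw [mul_smul_comm, smul_mul_assoc, hcomm k l]
  have hPN : ∀ k, P k * aeval (∑ l : Fin (b + 1), ((l : ℕ) : K) • r l) (∏ l : Fin (b + 1), (X - C ((l : ℕ) : K))) =
      aeval (∑ l : Fin (b + 1), ((l : ℕ) : K) • r l) (∏ l : Fin (b + 1), (X - C ((l : ℕ) : K))) * P k :=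
    fun k => mul_aeval_comm _ _ (hPD k) _
  obtain ⟨B, hB, hPB⟩ := exists_generalized_inverse_commuting P hP hPorth hPsum _ hPN
  set D : Matrix (Fin d) (Fin d) K := ∑ l : Fin (b + 1), ((l : ℕ) : K) • r l with hD
  set Pn : K[X] := ∏ l : Fin (b + 1), (X - C ((l : ℕ) : K)) with hPn
  set N : Matrix (Fin d) (Fin d) K := aeval D Pn with hN
  have hvan : ∀ q : K[X], (∀ j : Fin (b + 1), eval ((fun k : Fin (b + 1) => ((k : ℕ) : K)) j) q = 0) →
      aeval D q * (1 - B * N) = 0 :=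
    fun q hq => aeval_mul_kerProj_eq_zero D B Pn q hB (nodal_dvd_of_eval_eq_zero hv q hq)
  have hLN : ∀ k : Fin (b + 1),
      aeval D (Lagrange.basis univ (fun k : Fin (b + 1) => ((k : ℕ) : K)) k) * N =
        N * aeval D (Lagrange.basis univ (fun k : Fin (b + 1) => ((k : ℕ) : K)) k) :=
    fun k => aeval_mul_comm D _ _
  have hLL : ∀ k l : Fin (b + 1), k ≠ l →
      aeval D (Lagrange.basis univ (fun k : Fin (b + 1) => ((k : ℕ) : K)) k) *
        aeval D (Lagrange.basis univ (fun k : Fin (b + 1) => ((k : ℕ) : K)) l) * (1 - B * N) = 0 := by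
    intro k l hkl
    have h := hvan _ (eval_basis_mul_basis_of_ne hkl)
    rwa [map_mul] at h
  have hL2 : ∀ k : Fin (b + 1),
      (aeval D (Lagrange.basis univ (fun k : Fin (b + 1) => ((k : ℕ) : K)) k) *
        aeval D (Lagrange.basis univ (fun k : Fin (b + 1) => ((k : ℕ) : K)) k) -
        aeval D (Lagrange.basis univ (fun k : Fin (b + 1) => ((k : ℕ) : K)) k)) * (1 - B * N) = 0 := by
    intro k
    have h := hvan _ (eval_basis_sq_sub_basis hv k)
    rwa [map_sub, map_mul] at h
  have hLsum : ∑ k, aeval D (Lagrange.basis univ (fun k : Fin (b + 1) => ((k : ℕ) : K)) k) = 1 := by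
    rw [← map_sum, sum_basis_eq_one hv, map_one]
  have hLE : (∑ k : Fin (b + 1), ((k : ℕ) : K) •
      aeval D (Lagrange.basis univ (fun k : Fin (b + 1) => ((k : ℕ) : K)) k) - D) * (1 - B * N) = 0 := by
    have h := hvan _ (eval_sum_C_mul_basis_sub_X hv)
    simpa only [map_sub, aeval_X, map_sum, map_mul, aeval_C, Algebra.algebraMap_eq_smul_one, smul_one_mul]
      using h
  obtain ⟨Q, hQidem, hQorth, hQsum, -, hQdef⟩ := core_explicit D N B _ hB hLN hLL hL2 hLsum hLE
  refine ⟨Q, hQidem, hQorth, hQsum, fun k m => ?_, fun m => ?_⟩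
  · -- everything in the construction commutes with `P k`
    have h1 : P k * aeval D (Lagrange.basis univ (fun k : Fin (b + 1) => ((k : ℕ) : K)) m) =
        aeval D (Lagrange.basis univ (fun k : Fin (b + 1) => ((k : ℕ) : K)) m) * P k :=
      mul_aeval_comm _ _ (hPD k) _
    have h2 : P k * N = N * P k := mul_aeval_comm _ _ (hPD k) _
    have h3 : P k * (1 - B * N) = (1 - B * N) * P k := by
      rw [mul_sub, sub_mul, mul_one, one_mul, ← Matrix.mul_assoc, hPB k, Matrix.mul_assoc, h2, ← Matrix.mul_assoc]
    rw [hQdef m]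
    have h4 : P k * (1 - (1 - B * N)) = (1 - (1 - B * N)) * P k := by
      rw [mul_sub, sub_mul, mul_one, one_mul, h3]
    rw [mul_add, add_mul, ← Matrix.mul_assoc, h1, Matrix.mul_assoc, h3, ← Matrix.mul_assoc]
    congr 1
    split_ifs
    · exact h4
    · rw [Matrix.mul_zero, Matrix.zero_mul]
  · have hπ : (1 - (1 - B * N)).rank ≤ (b + 1) * ((b + 1) * s) + s := (rank_one_sub_kerProj N B).trans hNrank
    have e : Q m - r m =
        (aeval D (Lagrange.basis univ (fun k : Fin (b + 1) => ((k : ℕ) : K)) m) - r m) * (1 - B * N) -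
          r m * (1 - (1 - B * N)) + (if m = 0 then 1 - (1 - B * N) else 0) := by
      rw [hQdef m]; noncomm_ring
    rw [e]
    have hite : (if m = 0 then (1 : Matrix (Fin d) (Fin d) K) - (1 - B * N) else 0).rank ≤
        (b + 1) * ((b + 1) * s) + s := by
      split_ifs
      · exact hπ
      · rw [Matrix.rank_zero]; exact Nat.zero_le _
    refine (rk_add _ _).trans ?_
    refine (Nat.add_le_add ((rk_sub _ _).trans (Nat.add_le_add
      ((Matrix.rank_mul_le_left _ _).trans (hLr m)) ((Matrix.rank_mul_le_right _ _).trans hπ))) hite).trans ?_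
    have h1 : (b + 1) * ((b + 1) * s) + s ≤ (b + 2) ^ 2 * s := by nlinarith
    nlinarith

/-- THE TWO-FAMILY STEP: an exact complete orthogonal family `R` that almost commutes with an exact complete orthogonal
family `P` (`∑_k rank [R_l, P_k] ≤ s` for each `l`) is within rank `10(b+2)²s` of an exact complete orthogonal family
`R'` that commutes with every `P_k` (char 0). -/
theorem twoFamily_stable [CharZero K] (P : Fin (a + 1) → Matrix (Fin d) (Fin d) K)
    (hP : ∀ k, P k * P k = P k) (hPorth : ∀ k l, k ≠ l → P k * P l = 0) (hPsum : ∑ k, P k = 1)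
    (R : Fin (b + 1) → Matrix (Fin d) (Fin d) K)
    (hR : ∀ l, R l * R l = R l) (hRorth : ∀ l m, l ≠ m → R l * R m = 0) (hRsum : ∑ l, R l = 1) (s : ℕ)
    (hcomm : ∀ l, ∑ k, (R l * P k - P k * R l).rank ≤ s) :
    ∃ R' : Fin (b + 1) → Matrix (Fin d) (Fin d) K,
      (∀ l, R' l * R' l = R' l) ∧ (∀ l m, l ≠ m → R' l * R' m = 0) ∧ (∑ l, R' l = 1) ∧
      (∀ k l, P k * R' l = R' l * P k) ∧ ∀ l, (R' l - R l).rank ≤ 10 * (b + 2) ^ 2 * s := by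
  -- the compression `R̃_l = ∑ P_k R_l P_k`
  set Rc : Fin (b + 1) → Matrix (Fin d) (Fin d) K := fun l => ∑ k, P k * R l * P k with hRc
  have hΔ : ∀ l, (Rc l - R l).rank ≤ s := by
    intro l
    have e : Rc l - R l = -(∑ k, (R l * P k - P k * R l) * P k) := by
      have h1 : ∑ k, (R l * P k - P k * R l) * P k = R l * ∑ k, P k - Rc l := by
        simp only [hRc, sub_mul, Finset.sum_sub_distrib, Matrix.mul_assoc, hP, Finset.mul_sum]
      rw [h1, hPsum, mul_one, neg_sub]
    rw [e, rk_neg]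
    exact (rank_sum_le _ _).trans
      ((Finset.sum_le_sum fun k _ => Matrix.rank_mul_le_left _ _).trans (hcomm l))
  have hcommc : ∀ k l, P k * Rc l = Rc l * P k := fun k l => compression_commutes P hP hPorth (R l) k
  have hsumc : ∑ l, Rc l = 1 := by
    simp only [hRc]
    rw [Finset.sum_comm]
    simp only [← Finset.mul_sum, ← Finset.sum_mul, hRsum, mul_one, hP, hPsum]
  -- defects of the compressed family
  have hidemc : ∀ l, (Rc l * Rc l - Rc l).rank ≤ 3 * s := by
    intro l
    have e0 : Rc l * Rc l - Rc l - (R l * (Rc l - R l) + (Rc l - R l) * R l + (Rc l - R l) * ((Rc l - R l) - 1)) =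
        R l * R l - R l := by
      noncomm_ring
    have e : Rc l * Rc l - Rc l =
        R l * (Rc l - R l) + (Rc l - R l) * R l + (Rc l - R l) * ((Rc l - R l) - 1) := by
      rw [hR l, sub_self, sub_eq_zero] at e0; exact e0
    rw [e]
    refine (rk_add _ _).trans ((Nat.add_le_add ((rk_add _ _).trans (Nat.add_le_add
      ((Matrix.rank_mul_le_right _ _).trans (hΔ l)) ((Matrix.rank_mul_le_left _ _).trans (hΔ l))))
      ((Matrix.rank_mul_le_left _ _).trans (hΔ l))).trans ?_)
    omega
  have horthc : ∀ l m, l ≠ m → (Rc l * Rc m).rank ≤ 3 * s := by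
    intro l m hlm
    have e0 : Rc l * Rc m - (R l * (Rc m - R m) + (Rc l - R l) * R m + (Rc l - R l) * (Rc m - R m)) =
        R l * R m := by
      noncomm_ring
    have e : Rc l * Rc m = R l * (Rc m - R m) + (Rc l - R l) * R m + (Rc l - R l) * (Rc m - R m) := by
      rw [hRorth l m hlm, sub_eq_zero] at e0; exact e0
    rw [e]
    refine (rk_add _ _).trans ((Nat.add_le_add ((rk_add _ _).trans (Nat.add_le_add
      ((Matrix.rank_mul_le_right _ _).trans (hΔ m)) ((Matrix.rank_mul_le_left _ _).trans (hΔ l))))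
      ((Matrix.rank_mul_le_left _ _).trans (hΔ l))).trans ?_)
    omega
  have honec : (∑ l, Rc l - 1).rank ≤ 3 * s := by
    rw [hsumc, sub_self, Matrix.rank_zero]; exact Nat.zero_le _
  obtain ⟨Q, hQ, hQorth, hQsum, hQcomm, hQd⟩ :=
    orthogonalFamily_stable_commuting P hP hPorth hPsum Rc (3 * s) hidemc horthc honec hcommc
  refine ⟨Q, hQ, hQorth, hQsum, hQcomm, fun l => ?_⟩
  have e : Q l - R l = (Q l - Rc l) + (Rc l - R l) := by abel
  rw [e]
  refine (rk_add _ _).trans ?_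
  obtain ⟨X, hX⟩ : ∃ X, X = (b + 2) ^ 2 * s := ⟨_, rfl⟩
  have h1 : (Q l - Rc l).rank ≤ 9 * X := by
    rw [hX]; calc _ ≤ _ := hQd l
      _ = _ := by ring
  have h2 := hΔ l
  have h3 : s ≤ X := by rw [hX]; exact Nat.le_mul_of_pos_left s (by positivity)
  rw [show 10 * (b + 2) ^ 2 * s = 10 * X by rw [hX]; ring]
  omega

end Summit.PneNP.PneNP.Theorems.CnfIdealGenLengthRankDefectRepresentationsTwoFamilyStability
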